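import Literature.Computability.AlgebraicComplexity.CKSV22EsymRobustBounds
import HarnessLib

/-!
# Chatterjee–Kumar–She–Volk 2022, §5.2–5.3: the quadratic formula lower bound for `ESYM` (Theorem 3)

P. Chatterjee, M. Kumar, A. She, B. L. Volk, *Quadratic lower bounds for algebraic branching programs
and formulas*, comput. complex. **31** (2022) 8 (arXiv:1911.11793), §5.2 ("A degree reduction
procedure", TeX L799–866) and §5.3 ("A quadratic lower bound for formulas", L868–951).

**The model** (L800–804): "It is common to define the size of the formula as the number of leaves
… For us it is a bit more convenient to define the size of the formulas as the number of leaves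
labeled by *variables* (rather than field constants) … The formal degree of a vertex in the formula
is defined by induction in the natural way. If `v` is a leaf labeled by variable, its formal degree
is `1`. If `v` is a leaf labeled by a field constant, its formal degree is `0`. The formal degree of
a sum gate is the maximum between the formal degree of its children, and the formal degree of a
product gate is the sum of the formal degrees of its children."

**Theorem 3** (L131–134 / L664): "any algebraic formula over `𝔽` computing the elementary symmetric
polynomial `ESYM(n, 0.1n)` … has size at least `Ω(n²)`" (fields of characteristic `> 0.1n`; the
tree's Lemma 21 carries the corrected hypothesis "`1, …, n ≠ 0`").

## What is formalised

* `CKSV2022.Formula n K` — formulas (fan-in-2 `+`/`×` trees, leaves = variables `x_i`, `i < n`, or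
  constants), with `size` (number of variable leaves), `fdeg` (formal degree) and `eval` (the
  polynomial computed), exactly as in L800–804; `fdeg_le_size` = **Observation 28** ("The size of
  a formula is at least as large as its formal degree"); `totalDegree_eval_le_fdeg`.
* `CKSV2022.lemma_29` — **Lemma 29** (intermediate-degree vertex + surgery, L814–829): if
  `2t ≤ fdeg Φ` (`1 ≤ t`) there are a sub-formula `v` with `t ≤ fdeg v ≤ 2t − 1` and `h, f` with
  `Φ ≡ h·Φ_v + f`, and for every `γ` a formula of size `≤ |Φ| − |Φ_v|` (and formal degree
  `≤ fdeg Φ`) computing `γh + f`. Proof as printed (walk down to the larger child; replace the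
  subtree by the constant `γ`), by structural induction.
* `CKSV2022.lemma_30` — **Lemma 30** (L832–866) with the threshold `t` as a free parameter (the
  print takes `t = ⌊d/3⌋` for `d = fdeg Φ`; its proof is verbatim for any `t ≥ 1`):
  `Φ ≡ Φ' + Σ_{i<k} g_i h_i + c` with `g_i(0) = h_i(0) = 0`, `fdeg Φ' ≤ 2t − 1`, `|Φ'| ≤ |Φ|`,
  `k·t ≤ |Φ|`. Proof as printed (strip constants `α = Φ_v(0)`, `β = h(0)`; induct on the size).
* `CKSV2022.chatterjeeKumarSheVolk2022_thm_31` — **Theorem 31** (robust bound for formulas),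
  general degree, explicit, the printed formal-degree hypothesis dropped: a formula computing
  `e_{n,d} + Σ_{j<r} A_jB_j + R` (`A_j(0) = B_j(0) = 0`, `deg R < d`) has
  `(n − (d−2) − 2r)·⌊d/3⌋ ≤ 2·size` (`3 ≤ d ≤ n`, `1, …, n ≠ 0` in `K`); Lemma 30 with `t = ⌊d/3⌋`
  and the robust counting step `esymm_robust_counting` (Lemma 24).
* `CKSV2022.chatterjeeKumarSheVolk2022_thm_3` — **Theorem 3, explicit and for every degree**:
  every formula computing `e_{n,d}` (`3 ≤ d ≤ n`, `1, …, n ≠ 0` in `K`) has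
  `(n − (d−2))·⌊d/3⌋ ≤ 2·size`; for `d = 0.1n` this is `size ≥ 0.015n² − O(n)`, i.e. `Ω(n²)`.
  **Disclosed shorter road:** the printed proof iterates Claim 32 (formal degree `d_k → 2d_k/3`,
  error terms accumulating geometrically) until the formal degree is `≤ 0.1n` and then applies
  Theorem 31; since Lemma 30 holds for ANY threshold `t`, a single application with `t = ⌊d/3⌋`
  to the original formula (whatever its formal degree) already writes `e_{n,d} = Σ_{i<k} g_ih_i +`
  (a polynomial of degree `≤ 2⌊d/3⌋ − 1 < d`) with `k⌊d/3⌋ ≤ size`, and Lemma 24's counting step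
  gives `n − (d−2) ≤ 2k` — no iteration and a better constant.

D-0026: no named facts. Definitions: `Formula`, `Formula.size`, `Formula.fdeg`, `Formula.eval`
(the printed model; bodies, no axioms).

## References
* [ChatterjeeKumarSheVolk2022] — §5.2 (L799–866: model, Obs. 28, Lemma 29, Lemma 30), §5.3
  (L868–951: Thm. 31, Claim 32, Thm. 3), Lemma 24.
-/

noncomputable section

open MvPolynomial Finset

namespace Literature.Computability.AlgebraicComplexity

namespace CKSV2022

/-- **CKSV formulas** (§5.2, TeX L800–804): binary `+`/`×` trees whose leaves are variables `x_i`
(`i < n`) or field constants. [cite: ChatterjeeKumarSheVolk2022, §5.2 (L800–804)] -/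
inductive Formula (n : ℕ) (K : Type*) : Type _
  | var : Fin n → Formula n K
  | const : K → Formula n K
  | add : Formula n K → Formula n K → Formula n K
  | mul : Formula n K → Formula n K → Formula n K

namespace Formula

variable {n : ℕ} {K : Type*}

/-- Size = number of leaves labelled by variables (L800: "the number of leaves labeled by
*variables* (rather than field constants)"). [cite: ChatterjeeKumarSheVolk2022, §5.2 (L800)] -/
def size : Formula n K → ℕ
  | var _ => 1
  | const _ => 0
  | add φ ψ => size φ + size ψ
  | mul φ ψ => size φ + size ψ

/-- Formal degree (L802: variable leaf `1`, constant leaf `0`, sum gate `max`, product gate `+`).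
[cite: ChatterjeeKumarSheVolk2022, §5.2 (L802–804)] -/
def fdeg : Formula n K → ℕ
  | var _ => 1
  | const _ => 0
  | add φ ψ => max (fdeg φ) (fdeg ψ)
  | mul φ ψ => fdeg φ + fdeg ψ

/-- The polynomial computed by a formula. [cite: ChatterjeeKumarSheVolk2022, §5.2 (L812)] -/
def eval [CommSemiring K] : Formula n K → MvPolynomial (Fin n) K
  | var i => X i
  | const c => C c
  | add φ ψ => eval φ + eval ψ
  | mul φ ψ => eval φ * eval ψ

/-- Unfolding of the size (definition, L800–804). [cite: ChatterjeeKumarSheVolk2022, §5.2 (L800–804)] -/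
@[simp] theorem size_var (i : Fin n) : (var i : Formula n K).size = 1 := rfl
/-- Unfolding of the size (definition, L800–804). [cite: ChatterjeeKumarSheVolk2022, §5.2 (L800–804)] -/
@[simp] theorem size_const (c : K) : (const c : Formula n K).size = 0 := rfl
/-- Unfolding of the size (definition, L800–804). [cite: ChatterjeeKumarSheVolk2022, §5.2 (L800–804)] -/
@[simp] theorem size_add (φ ψ : Formula n K) : (add φ ψ).size = φ.size + ψ.size := rfl
/-- Unfolding of the size (definition, L800–804). [cite: ChatterjeeKumarSheVolk2022, §5.2 (L800–804)] -/
@[simp] theorem size_mul (φ ψ : Formula n K) : (mul φ ψ).size = φ.size + ψ.size := rfl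
/-- Unfolding of the formal degree (definition, L800–804). [cite: ChatterjeeKumarSheVolk2022, §5.2 (L800–804)] -/
@[simp] theorem fdeg_var (i : Fin n) : (var i : Formula n K).fdeg = 1 := rfl
/-- Unfolding of the formal degree (definition, L800–804). [cite: ChatterjeeKumarSheVolk2022, §5.2 (L800–804)] -/
@[simp] theorem fdeg_const (c : K) : (const c : Formula n K).fdeg = 0 := rfl
/-- Unfolding of the formal degree (definition, L800–804). [cite: ChatterjeeKumarSheVolk2022, §5.2 (L800–804)] -/
@[simp] theorem fdeg_add (φ ψ : Formula n K) : (add φ ψ).fdeg = max φ.fdeg ψ.fdeg := rfl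
/-- Unfolding of the formal degree (definition, L800–804). [cite: ChatterjeeKumarSheVolk2022, §5.2 (L800–804)] -/
@[simp] theorem fdeg_mul (φ ψ : Formula n K) : (mul φ ψ).fdeg = φ.fdeg + ψ.fdeg := rfl

section Eval

variable [CommSemiring K]

/-- Unfolding of the evaluation (definition, L800–804). [cite: ChatterjeeKumarSheVolk2022, §5.2 (L800–804)] -/
@[simp] theorem eval_var (i : Fin n) : (var i : Formula n K).eval = X i := rfl
/-- Unfolding of the evaluation (definition, L800–804). [cite: ChatterjeeKumarSheVolk2022, §5.2 (L800–804)] -/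
@[simp] theorem eval_const (c : K) : (const c : Formula n K).eval = C c := rfl
/-- Unfolding of the evaluation (definition, L800–804). [cite: ChatterjeeKumarSheVolk2022, §5.2 (L800–804)] -/
@[simp] theorem eval_add (φ ψ : Formula n K) : (add φ ψ).eval = φ.eval + ψ.eval := rfl
/-- Unfolding of the evaluation (definition, L800–804). [cite: ChatterjeeKumarSheVolk2022, §5.2 (L800–804)] -/
@[simp] theorem eval_mul (φ ψ : Formula n K) : (mul φ ψ).eval = φ.eval * ψ.eval := rfl

end Eval

/-- **Observation 28** ("The size of a formula is at least as large as its formal degree").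
[cite: ChatterjeeKumarSheVolk2022, Observation 28] -/
theorem fdeg_le_size (Φ : Formula n K) : Φ.fdeg ≤ Φ.size := by
  induction Φ with
  | var i => simp
  | const c => simp
  | add φ ψ hφ hψ => simp only [fdeg_add, size_add]; omega
  | mul φ ψ hφ hψ => simp only [fdeg_mul, size_mul]; omega

/-- The computed polynomial has degree at most the formal degree.
[cite: ChatterjeeKumarSheVolk2022, §5.2 (L802–804)] -/
theorem totalDegree_eval_le_fdeg {F : Type*} [Field F] (Φ : Formula n F) :
    Φ.eval.totalDegree ≤ Φ.fdeg := by
  induction Φ with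
  | var i => rw [Formula.eval_var, totalDegree_X, fdeg_var]
  | const c => simp
  | add φ ψ hφ hψ =>
    simp only [Formula.eval_add, fdeg_add]
    exact (totalDegree_add _ _).trans (max_le_max hφ hψ)
  | mul φ ψ hφ hψ =>
    simp only [Formula.eval_mul, fdeg_mul]
    exact (totalDegree_mul _ _).trans (Nat.add_le_add hφ hψ)

end Formula

open Formula

section DegreeReduction

variable {n : ℕ} {K : Type*} [Field K]

/-- **Lemma 29** (L814–829): in a formula of formal degree `≥ 2t` (`t ≥ 1`) there is a sub-formula
`v` of formal degree in `[t, 2t−1]` with `Φ ≡ h·Φ_v + f`, and for every `γ ∈ K` the polynomial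
`γh + f` is computed by a formula of size `≤ |Φ| − |Φ_v|` (and formal degree `≤ fdeg Φ`): "we start
from the root of `Φ` and traverse down, such that in every step if the degree of the current vertex
`w` is at least `2t`, then we traverse down to its child with the larger degree … replacing the leaf
labeled `y` in `Φ'` by the constant `γ`". [cite: ChatterjeeKumarSheVolk2022, Lemma 29] -/
theorem lemma_29 {t : ℕ} (ht : 1 ≤ t) (Φ : Formula n K) (hΦ : 2 * t ≤ Φ.fdeg) :
    ∃ (v : Formula n K) (h f : MvPolynomial (Fin n) K),
      t ≤ v.fdeg ∧ v.fdeg ≤ 2 * t - 1 ∧ Φ.eval = h * v.eval + f ∧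
        ∀ γ : K, ∃ Ψ : Formula n K,
          Ψ.size + v.size ≤ Φ.size ∧ Ψ.fdeg ≤ Φ.fdeg ∧ Ψ.eval = C γ * h + f := by
  induction Φ with
  | var i => simp at hΦ; omega
  | const c => simp at hΦ; omega
  | add φ ψ ihφ ihψ =>
    simp only [fdeg_add] at hΦ
    rcases le_total ψ.fdeg φ.fdeg with hle | hle
    · -- descend into `φ`
      obtain ⟨v, h, f, hv1, hv2, heq, hsurg⟩ := ihφ (by rw [max_eq_left hle] at hΦ; exact hΦ)
      refine ⟨v, h, f + ψ.eval, hv1, hv2, by rw [Formula.eval_add, heq]; ring, fun γ => ?_⟩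
      obtain ⟨Ψ, hs, hd, he⟩ := hsurg γ
      refine ⟨add Ψ ψ, ?_, ?_, ?_⟩
      · simp only [size_add]; omega
      · simp only [fdeg_add]; exact max_le_max hd le_rfl
      · rw [Formula.eval_add, he]; ring
    · -- descend into `ψ`
      obtain ⟨v, h, f, hv1, hv2, heq, hsurg⟩ := ihψ (by rw [max_eq_right hle] at hΦ; exact hΦ)
      refine ⟨v, h, f + φ.eval, hv1, hv2, by rw [Formula.eval_add, heq]; ring, fun γ => ?_⟩
      obtain ⟨Ψ, hs, hd, he⟩ := hsurg γ
      refine ⟨add φ Ψ, ?_, ?_, ?_⟩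
      · simp only [size_add]; omega
      · simp only [fdeg_add]; exact max_le_max le_rfl hd
      · rw [Formula.eval_add, he]; ring
  | mul φ ψ ihφ ihψ =>
    simp only [fdeg_mul] at hΦ
    rcases le_total ψ.fdeg φ.fdeg with hle | hle
    · -- the larger child is `φ`, of formal degree `≥ t`
      by_cases hstop : φ.fdeg ≤ 2 * t - 1
      · -- stop at `φ`
        refine ⟨φ, ψ.eval, 0, by omega, hstop, by rw [Formula.eval_mul, add_zero, mul_comm], fun γ => ?_⟩
        refine ⟨mul (const γ) ψ, by simp [add_comm], by simp, by simp⟩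
      · obtain ⟨v, h, f, hv1, hv2, heq, hsurg⟩ := ihφ (by omega)
        refine ⟨v, h * ψ.eval, f * ψ.eval, hv1, hv2, by rw [Formula.eval_mul, heq]; ring, fun γ => ?_⟩
        obtain ⟨Ψ, hs, hd, he⟩ := hsurg γ
        refine ⟨mul Ψ ψ, ?_, ?_, ?_⟩
        · simp only [size_mul]; omega
        · simp only [fdeg_mul]; omega
        · rw [Formula.eval_mul, he]; ring
    · by_cases hstop : ψ.fdeg ≤ 2 * t - 1
      · refine ⟨ψ, φ.eval, 0, by omega, hstop, by rw [Formula.eval_mul, add_zero], fun γ => ?_⟩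
        refine ⟨mul φ (const γ), by simp, by simp, by simp; ring⟩
      · obtain ⟨v, h, f, hv1, hv2, heq, hsurg⟩ := ihψ (by omega)
        refine ⟨v, φ.eval * h, φ.eval * f, hv1, hv2, by rw [Formula.eval_mul, heq]; ring, fun γ => ?_⟩
        obtain ⟨Ψ, hs, hd, he⟩ := hsurg γ
        refine ⟨mul φ Ψ, ?_, ?_, ?_⟩
        · simp only [size_mul]; omega
        · simp only [fdeg_mul]; omega
        · rw [Formula.eval_mul, he]; ring

/-- **Lemma 30** (L832–866), with the threshold `t ≥ 1` free (the print takes `t = ⌊d/3⌋`,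
`d = fdeg Φ`; its proof — "keep extracting vertices of degree at least `t` till the total degree
becomes smaller than `2t`" — is verbatim for any `t`): `Φ ≡ Φ' + Σ_{i<k} g_i h_i + c` with
`g_i(0) = h_i(0) = 0`, `fdeg Φ' ≤ 2t − 1`, `|Φ'| ≤ |Φ|` and `k·t ≤ |Φ|`. NOT carried in the typed
conclusion (weaker than print, unused by Thm 31 / Thm 3): the printed degree bullets "the degree of each
`g_i` is at least `⌊d/3⌋` and at most `2⌊d/3⌋ − 1` and each `h_i` has degree at least `1`" (held arXiv
text p0017.txt:L68) and the formal-degree window of `Φ'` stated there as `≤ 2⌊d/3⌋` (its proof gives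
`≤ 2t − 1`, which is what is typed). [cite: ChatterjeeKumarSheVolk2022, Lemma 30] -/
theorem lemma_30 {t : ℕ} (ht : 1 ≤ t) (Φ : Formula n K) :
    ∃ (k : ℕ) (g h : Fin k → MvPolynomial (Fin n) K) (Φ' : Formula n K) (c : K),
      (∀ i, constantCoeff (g i) = 0) ∧ (∀ i, constantCoeff (h i) = 0) ∧
        Φ'.fdeg ≤ 2 * t - 1 ∧ Φ'.size ≤ Φ.size ∧ k * t ≤ Φ.size ∧
          Φ.eval = Φ'.eval + ∑ i, g i * h i + C c := by
  -- induction on the size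
  induction hs : Φ.size using Nat.strong_induction_on generalizing Φ with
  | _ s ih =>
  by_cases hsmall : Φ.fdeg ≤ 2 * t - 1
  · refine ⟨0, Fin.elim0, Fin.elim0, Φ, 0, fun i => i.elim0, fun i => i.elim0, hsmall, hs.le,
      by simp, by simp⟩
  · -- one application of Lemma 29, constants stripped
    obtain ⟨v, h', f, hv1, hv2, heq, hsurg⟩ := lemma_29 ht Φ (by omega)
    obtain ⟨Ψ₁, hΨs, -, hΨe⟩ := hsurg (constantCoeff v.eval)
    have hvpos : 1 ≤ v.size := le_trans (le_trans ht hv1) (fdeg_le_size v)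
    have hΨlt : Ψ₁.size < s := by omega
    obtain ⟨k, g, hh, Φ', c, hg0, hh0, hΦ'd, hΦ's, hkt, hdec⟩ := ih Ψ₁.size hΨlt Ψ₁ rfl
    refine ⟨k + 1, Fin.snoc g (v.eval - C (constantCoeff v.eval)),
      Fin.snoc hh (h' - C (constantCoeff h')),
      add Φ' (mul (const (constantCoeff h')) v),
      c - constantCoeff v.eval * constantCoeff h', ?_, ?_, ?_, ?_, ?_, ?_⟩
    · intro i
      refine Fin.lastCases ?_ (fun j => ?_) i
      · simp
      · simpa using hg0 j
    · intro i
      refine Fin.lastCases ?_ (fun j => ?_) i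
      · simp
      · simpa using hh0 j
    · simp only [fdeg_add, fdeg_mul, fdeg_const, zero_add]
      exact max_le hΦ'd hv2
    · simp only [size_add, size_mul, size_const, zero_add]; omega
    · have := fdeg_le_size v; rw [Nat.succ_mul]; omega
    · rw [Fin.sum_univ_castSucc]
      simp only [Fin.snoc_castSucc, Fin.snoc_last, Formula.eval_add, Formula.eval_mul,
        Formula.eval_const, map_sub, map_mul]
      rw [heq]
      have e1 : C (constantCoeff v.eval) * h' + f = Φ'.eval + ∑ i, g i * hh i + C c := by
        rw [← hΨe, hdec]
      -- `h' v + f = g₁h₁ + β v + (α h' + f) − αβ`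
      linear_combination e1

end DegreeReduction

section LowerBound

variable {n : ℕ} {K : Type*} [Field K]

/-- **CKSV 2022, Theorem 31** (robust bound for formulas), general degree, explicit: a formula
computing `e_{n,d} + Σ_{j<r} A_j B_j + R` with `A_j(0) = B_j(0) = 0`, `deg R < d` has
`(n − (d−2) − 2r)·⌊d/3⌋ ≤ 2·size` (`3 ≤ d ≤ n`, `1, …, n ≠ 0` in `K`). Proof as printed: Lemma 30
with `t = ⌊d/3⌋`, then "`V' ⊆ V`, `V' ≠ ∅`, Lemma 24, Krull" = `esymm_robust_counting`. The
printed hypothesis "formal degree at most `d`" is not needed (Lemma 30 holds for any threshold),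
so it is dropped — the statement is the printed one for every formal degree.
[cite: ChatterjeeKumarSheVolk2022, Theorem 31] -/
theorem chatterjeeKumarSheVolk2022_thm_31 {d r : ℕ} (hd : 3 ≤ d) (hdn : d ≤ n)
    (hK : ∀ j : ℕ, 1 ≤ j → j ≤ n → (j : K) ≠ 0) (Φ : Formula n K)
    (A B : Fin r → MvPolynomial (Fin n) K)
    (hA0 : ∀ j, constantCoeff (A j) = 0) (hB0 : ∀ j, constantCoeff (B j) = 0)
    (R : MvPolynomial (Fin n) K) (hRd : R.totalDegree < d)
    (h : Φ.eval = esymm (Fin n) K d + ∑ j, A j * B j + R) :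
    (n - (d - 2) - 2 * r) * (d / 3) ≤ 2 * Φ.size := by
  classical
  have ht : 1 ≤ d / 3 := (Nat.le_div_iff_mul_le (by norm_num)).2 (by omega)
  obtain ⟨k, g, hh, Φ', c, hg0, hh0, hΦ'd, -, hkt, hdec⟩ := lemma_30 ht Φ
  have hrem : (Φ'.eval + C c - R).totalDegree < d := by
    refine Nat.lt_of_le_of_lt (totalDegree_sub _ _) (max_lt ?_ hRd)
    refine Nat.lt_of_le_of_lt (totalDegree_add _ _) (max_lt ?_ ?_)
    · have h1 := totalDegree_eval_le_fdeg Φ'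
      have h2 : 2 * (d / 3) - 1 < d := by omega
      omega
    · rw [totalDegree_C]; omega
  have key : esymm (Fin n) K d =
      ∑ x : Fin k ⊕ Fin r, Sum.elim g (fun j => -A j) x * Sum.elim hh B x +
        (Φ'.eval + C c - R) := by
    rw [Fintype.sum_sum_type]
    simp only [Sum.elim_inl, Sum.elim_inr, neg_mul, Finset.sum_neg_distrib]
    have : esymm (Fin n) K d = Φ.eval - ∑ j, A j * B j - R := by rw [h]; ring
    rw [this, hdec]; ring
  have hcount := esymm_robust_counting hd' hdn hK _ _ (fun x => ?_) (fun x => ?_) _ hrem key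
  rotate_left
  · rcases x with i | j
    · exact hg0 i
    · simp [hA0 j]
  · rcases x with i | j
    · exact hh0 i
    · exact hB0 j
  · rw [Fintype.card_sum, Fintype.card_fin, Fintype.card_fin] at hcount
    have h1 : n - (d - 2) - 2 * r ≤ 2 * k := by omega
    calc (n - (d - 2) - 2 * r) * (d / 3) ≤ 2 * k * (d / 3) := Nat.mul_le_mul_right _ h1
      _ = 2 * (k * (d / 3)) := by ring
      _ ≤ 2 * Φ.size := Nat.mul_le_mul_left 2 hkt
  where hd' : 2 ≤ d := by omega

/-- **CKSV 2022, Theorem 3, explicit and for every degree** ("any algebraic formula … computing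
`ESYM(n, 0.1n)` has size at least `Ω(n²)`"): every formula computing `e_{n,d}`, `3 ≤ d ≤ n`,
`1, …, n ≠ 0` in `K`, has `(n − (d−2))·⌊d/3⌋ ≤ 2·size` (so `size ≥ 0.015n² − O(n)` at `d = 0.1n`).
Disclosed shorter road (module docstring): one application of Lemma 30 with `t = ⌊d/3⌋` to the
given formula, whatever its formal degree, then Lemma 24's counting step — instead of the printed
iteration Claim 32 + Theorem 31. [cite: ChatterjeeKumarSheVolk2022, Theorem 3] -/
theorem chatterjeeKumarSheVolk2022_thm_3 {d : ℕ} (hd : 3 ≤ d) (hdn : d ≤ n)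
    (hK : ∀ j : ℕ, 1 ≤ j → j ≤ n → (j : K) ≠ 0) (Φ : Formula n K)
    (h : Φ.eval = esymm (Fin n) K d) : (n - (d - 2)) * (d / 3) ≤ 2 * Φ.size := by
  classical
  have ht : 1 ≤ d / 3 := (Nat.le_div_iff_mul_le (by norm_num)).2 (by omega)
  obtain ⟨k, g, hh, Φ', c, hg0, hh0, hΦ'd, -, hkt, hdec⟩ := lemma_30 ht Φ
  have hrem : (Φ'.eval + C c).totalDegree < d := by
    refine Nat.lt_of_le_of_lt (totalDegree_add _ _) (max_lt ?_ ?_)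
    · have h1 := totalDegree_eval_le_fdeg Φ'
      have h2 : 2 * (d / 3) - 1 < d := by omega
      omega
    · rw [totalDegree_C]; omega
  have key : esymm (Fin n) K d = ∑ i, g i * hh i + (Φ'.eval + C c) := by
    rw [← h, hdec]; ring
  have hcount := esymm_robust_counting (by omega) hdn hK g hh hg0 hh0 _ hrem key
  rw [Fintype.card_fin] at hcount
  calc (n - (d - 2)) * (d / 3) ≤ 2 * k * (d / 3) := Nat.mul_le_mul_right _ hcount
    _ = 2 * (k * (d / 3)) := by ring
    _ ≤ 2 * Φ.size := Nat.mul_le_mul_left 2 hkt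

end LowerBound

end CKSV2022

end Literature.Computability.AlgebraicComplexity

end
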